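import Summits.QuantumFields.YangMills.Theorems.BalabanUVNodesN15KingModelGraphTreeDecayExtLegs
import Summits.QuantumFields.YangMills.Theorems.BalabanUVNodesN15KingModelGraphPowerCountingSparse

/-!
# BalabanUVNodes ∕ N15 — THE KING-MODEL RUNG (PART Α-j): A HYPOTHESIS-FREE INSTANCE — the TRIANGLE (three `G`-lines, one loop) in King's own dimension
# `d + 1 = 4` with ANY family of King's external lines: (3.56) with its rate AND its exponential tree decay, every hypothesis discharged BY NAME or by `decide`
# (Track A, DAG node N15 = NE2; FAN-OUT v1.1 §N15 s3 «KING-MODEL RUNG … NE2's analogue DECIDED in the model»)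

HONEST FRAMING.  Count-neutral (cell `pub-ymgap`, seat `pub-ymgap-dag-n15-e` g29; `--supports stmt-QuantumFields-27366 --as helper` = K3⁸
`SpineGivenEndpointR13SepCoPHV`).  TEMPLATE LITERATURE: C. King, *The U(1) Higgs model. I. The continuum limit*, Commun. Math. Phys. **102** (1986) 649–677
[King1986], Proposition 3.6 (3.56) p. 662 — KING's OWN `A = 0` MODEL.  This file only INSTANTIATES part Α-g's `king_prop36_extLegs_treeDecay_collected` on the
triangle of parts Γ-j ∕ Δ-c ∕ Δ-d (connected by `lConn_triangle`; p. 664's «every subgraph has positive degree» by `posSubgraphsBy_triangle`, decided by counting), to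
exhibit the hypotheses of part Α as INHABITED: nothing is assumed beyond odd `L ≥ 3`, `a > 0`, `m₀² ≥ 0`.  NOT Bałaban's `G(U)`; NOT a node discharge; nothing
continuum ∕ ℝ⁴ ∕ OS ∕ mass-gap ∕ Clay.  0 `sorry`; standard axioms.

WHAT THIS FILE PROVES (namespace `Summit.QuantumFields.YangMills.BalabanUVNodes.N15KingModelRung.Curved`).
* `posSubgraphsBy_triangle_lineExp` (reading: Δ-c's certificate in part Α-f's spelling `PosSubgraphsBy triSrc triTgt 0 ((3+1 : ℕ) : ℝ) (lineExp 4 ∘ none)`).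
* ★★ **`king_prop36_triangle_extLegs_treeDecay`** — for `d + 1 = 4`: there are `A ≥ 1`, `γ, δ > 0` such that for every mass `0 < m² ≤ m₀²`, volume∕scale index,
  `n ≥ 1`, EVERY finite family of King's external lines on the triangle's vertices (one at the vertex `0`):
  `|E^{(K+n)}(△) − E^{(K)}(△)| ≤ exp[−δ·treeLength |·| {y_υ}]·L^{−γK}·(A^{8 + |Υ|}·6·(|Υ| + 4))` — the two-spacing rate of the one-loop triangle graph with
  its external legs decays exponentially in the tree length of the external points, with NO hypothesis left.

HONEST SCOPE.  An instance; the general statements are parts Α-e–Α-g.  Locators: [King1986] Prop. 3.6 (3.56) p.662, p.664, (3.77) p.666.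
-/

noncomputable section

namespace Summit.QuantumFields.YangMills.BalabanUVNodes.N15KingModelRung.Curved

open scoped BigOperators
open Finset
open Literature.MathematicalPhysics.QuantumFieldTheory.Balaban1983to89.B5Prop11Plancherel (Tor fine)
open Summit.QuantumFields.YangMills.BalabanUVNodes.N15KingModelRung (KingVolIndex kingVol kingVol_neZero basePt)
open Summit.QuantumFields.YangMills.BalabanUVNodes.N15KingModelRung.Graph

variable (L : ℕ) [NeZero L]

/-- reading: the triangle's subgraph certificate (part Δ-c, `dV = 4`, three `G`-lines, margin `0 < 2`) in part Α-f's spelling. [cite: King1986, p.664] -/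
theorem posSubgraphsBy_triangle_lineExp :
    PosSubgraphsBy triSrc triTgt 0 (((3 : ℕ) + 1 : ℕ) : ℝ) (fun ℓ => lineExp (3 + 1) ((fun _ : Fin 3 => (none : Option (Fin (3 + 1)))) ℓ)) := by
  have h := posSubgraphsBy_triangle (γ₁ := 0) (by norm_num)
  have e1 : (((3 : ℕ) + 1 : ℕ) : ℝ) = 4 := by norm_num
  have e2 : (fun ℓ : Fin 3 => lineExp (3 + 1) ((fun _ : Fin 3 => (none : Option (Fin (3 + 1)))) ℓ)) = fun _ => (2 : ℝ) - 4 := by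
    funext ℓ; simp only [lineExp_none]; push_cast; ring
  rw [e1, e2]
  exact h

/-- ★★ **THE TRIANGLE WITH KING's EXTERNAL LINES: (3.56) WITH ITS RATE AND ITS TREE DECAY, NO HYPOTHESIS** (King's own dimension `d + 1 = 4`): part Α-g's
`king_prop36_extLegs_treeDecay_collected` at `nn = 2`, `m = 3`, `κ ≡ G`, connectedness `lConn_triangle` (part Δ-d) and the subgraph condition `posSubgraphsBy_triangle`
(part Δ-c, by counting).  For every family `Υ` of external lines (blocks `b_υ`, kinds `κₑ_υ`, `υ₀` at the vertex `0`):
`|E^{(K+n)}(△) − E^{(K)}(△)| ≤ exp[−δ·treeLength |·| {y_υ}]·L^{−γK}·(A^{8 + |Υ|}·(6·(|Υ| + 4)))`.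
[cite: King1986, Prop. 3.6 (3.56) p.662, p.664 («every subgraph has positive degree»), (3.77) p.666] -/
theorem king_prop36_triangle_extLegs_treeDecay (hLodd : Odd L) (hL : 2 ≤ L) {a : ℝ} (ha : 0 < a) {m0sq : ℝ} (hm0 : 0 ≤ m0sq) :
    ∃ A γ δ : ℝ, 1 ≤ A ∧ 0 < γ ∧ 0 < δ ∧ ∀ (msq : ℝ), 0 < msq → msq ≤ m0sq → ∀ (jv : KingVolIndex 3) (n : ℕ), 1 ≤ n →
      ∀ (Υ : Type) [Fintype Υ] [DecidableEq Υ] (vtx : Υ → Fin (2 + 1)) (υ₀ : Υ), vtx υ₀ = 0 →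
      ∀ (b : Υ → Tor (kingVol L jv)) (κe : Υ → Option (Fin (3 + 1))),
        haveI := kingVol_neZero L jv
        |graphValLS ((((L : ℝ) ^ (jv.K + n))⁻¹) ^ (3 + 1)) triSrc triTgt (fun _ => kingGLine L (kingVol L jv) a msq (jv.K + n) none) vtx
              (fun υ => kingExtHi L a msq jv n (b υ) (κe υ))
            - graphValLS ((((L : ℝ) ^ jv.K)⁻¹) ^ (3 + 1)) triSrc triTgt (fun _ => kingGLine L (kingVol L jv) a msq jv.K none) vtx
              (fun υ => kingExtLo L a msq jv (b υ) (κe υ))|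
          ≤ Real.exp (-(δ * treeLength (kingDist L jv) (anchors fun υ => some (basePt (L ^ jv.K) (kingVol L jv) (b υ)))))
            * (L : ℝ) ^ (-(γ * jv.K)) * (A ^ (8 + Fintype.card Υ) * ((6 : ℝ) * (Fintype.card Υ + 4))) := by
  obtain ⟨A, γ, δ, hA, hγ, hδ, H⟩ := king_prop36_extLegs_treeDecay_collected (d := 3) L hLodd hL ha hm0
  refine ⟨A, γ, δ, hA, hγ, hδ, fun msq hm hcap jv n hn Υ _ _ vtx υ₀ hυ₀ b κe => ?_⟩
  haveI := kingVol_neZero L jv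
  have key := H msq hm hcap jv n hn 2 3 triSrc triTgt lConn_triangle (fun _ => none) (posSubgraphsBy_triangle_lineExp) Υ vtx υ₀ hυ₀ b κe
  refine key.trans (le_of_eq ?_)
  have e1 : 2 * 3 + 2 + Fintype.card Υ = 8 + Fintype.card Υ := by ring
  have e2 : ((Nat.factorial 3 : ℕ) : ℝ) = 6 := by norm_num [Nat.factorial]
  rw [e1, e2]
  push_cast
  ring

end Summit.QuantumFields.YangMills.BalabanUVNodes.N15KingModelRung.Curved

end
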